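import Mathlib
import HarnessLib
import Summits.Langlands.Langlands.Theses.QuarterDeficit1951

/-!
# Line `GapReadout` (alt line, crux-strategist gen 1) — crux stmt-Langlands-15897
`Summit.Langlands.Langlands.Theses.QuarterDeficit1951.QuarterFingerprintDeficit` (C1)

REFUTATION-FIRST line (as `Sketch` and `ParityPurePoint`): the composition concludes `¬ QuarterFingerprintDeficit`.
C1 is numerically FALSE (odd `λ = 1/4` newforms for all four order-5 `χ`, Cruxes/…/SightingHejhalR0.md); what is
open is a CERTIFICATE (verdict class `computation`). The two registered certificate lines (`Sketch` stub D,
`ParityPurePoint` P4) both IDENTIFY the Hecke eigenvalues through the JOINT quasimode pigeonhole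
(BSV 2006 Lemma 3.2, landed abstract core p128255), which needs certified bounds `‖(T_p − a_p) g̃‖` for the six
primes `p ≤ 13` over the WHOLE level-1951 fundamental domain — a Taylor atlas of `~10⁴`-term two-cusp
expansions down to height `y_min / 13 ≈ 3·10⁻⁵` (PICKED c1 (iii); the 30–100 core-day, engineering-heavy item;
lead job j023192 errored 2026-08-17T06:53Z).

LEVER (three moves, each standard alone; new is the cut): ISOLATE, then READ.
(1) ISOLATION = COUNTING with `n = ±1` ONLY. In the odd sector of `(Γ₀(1951), χ)` (purely cuspidal: order-5 `χ`
    is even, 1951 prime ⇒ both Eisenstein families are `R`-even — line ParityPurePoint) the number of Laplace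
    eigenvalues with `|λ − 1/4| ≤ 10⁻⁴` is AT MOST ONE. This is a trace-formula statement for `tr(T₁ − T₋₁)/2`
    — Booker–Lee–Strömbergsson 2020 Thm 7 treats exactly `n ∈ {±1}` on `(Γ₀(N), χ)` and §5 reports the Arb run
    `Q_{χ,odd} < 1` for the twist-minimal spaces of Thm 2, N = 1951 included: with `m_χ = 1`, `n_{χ,odd} = 1`,
    `h ≥ 0`, `h(0) = 1` it reads `Σ_{odd j} h(r_j) < 2`, i.e. at most one odd eigenvalue wherever
    `h > (1 + Q)/2` — a micro-window around `r = 0` (and all of `iℝ`). NO Hecke trace formula (`n = p`) is needed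
    (the landed census format notes that one is "NOT in [BLS20]"). Sources for the certificate: BLS's own run
    (logs/minimiser requested, lit acq), a re-run of Thm 7 (`X ≤ 40`, class numbers `h(t² ∓ 4)`, `t ≤ e^{20}` —
    the SAME `n = 1` evaluator the sibling crux `CensusDeficit1951` needs), or EXHAUSTION at small `X`
    (`t ≤ e^{13..16}`, class numbers by direct enumeration) + coarse odd quasimodes for the `~80·W²` lowest odd
    eigenvalues found by a Hejhal scan (each certified to `10⁻³` only).
(2) EXISTENCE = an odd quasimode `g̃` (exact `ℤ[ζ₅]` Artin ansatz, `r = 0`, `M ≈ 1.2–2.5·10⁴` terms, point-pair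
    smoothing of free radius `δ ≈ 0.1`) with RELATIVE defect `‖(Δ − 1/4) g̃‖ ≤ ε ‖g̃‖`, `ε ≈ 5·10⁻¹¹`, from
    certified JUMP bounds `≈ 5·10⁻¹⁴` across the `~10³` side-paired floor arcs of the Ford domain
    `D = D⁺ ∪ W_N D⁺` (`D⁺` = Ford domain of `Γ₀⁺(1951)`; `D⁺ ⊇ {|x| ≤ 1/2, Im z > 1951^{-1/2} = 0.0226}`, on
    which `g̃ = f_M` EXACTLY) — the lead's step (iii-a) at 13 digits, not 22 (Child's `δ < 2.3·10⁻⁷` is an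
    artifact of his tile-corner condition). Child 2022 Lemma 4 in `L²_odd` gives an odd cusp form with
    `|λ − 1/4| ≤ ε`.
(3) IDENTIFICATION = READOUT, not pigeonhole. If `u` spans the `10⁻⁴`-window of `Δ_odd` (by (1),(2)), then for
    every bounded normal `T` commuting with `Δ, R` (so `T u = μ u`) and EVERY test vector `φ`:
    `|⟨T g̃, φ⟩ − μ ⟨g̃, φ⟩| ≤ (ε/γ) ‖g̃‖ (‖T‖ + |μ|) ‖φ‖` (`γ` = distance from `1/4` to the rest of the odd
    spectrum ≥ `10⁻⁴ − ε`). Take `φ = g̃·1_Ω`, `Ω = {|x| ≤ 1/2, 0.33 ≤ y ≤ 0.66}`: all Hecke points `(z+b)/p`,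
    `p z` of `Ω` lie (mod `T`) above height `0.025 > 1951^{-1/2} e^{δ}`, where `g̃ = f_M` and hence
    `T_p g̃ = a_p f_M + (explicit tail)` EXACTLY (Child Lemma 6 shape). So
    `|μ_p − a_p| ≤ |⟨tail_p, f_M⟩_Ω| / ‖f_M‖²_Ω + 2 ((p+1)/√p) (ε/γ) ‖g̃‖_X / ‖f_M‖_Ω`, and EVERY quantity on
    the right is a PARSEVAL 1-D integral `Σ_n |a_n|² ∫ 2 K₀(2πny)² dy/y` (full periods in `x`) or the `ε` of (2):
    no bulk atlas, no evaluation below height `0.33`, all six primes at once (MEASURED, kit j024768: `‖f_M‖²_Ω = 3.73·10⁻³`,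
    strip Parseval bound `‖g̃‖²_X ≤ 3.86·10³`, ratio `≤ 1017` ⇒ `ε/γ ≤ 5.1·10⁻⁷` suffices for `|μ_p − a_p| ≤ 1/250` at the binding p = 13).
Composition below: P1 (odd ⇒ constant terms, PROVED in Lines/ParityPurePointStubOddConstantTermsProof.lean) +
A (`OddMicroWindowUnique`) + B (`OddMicroWindowForm`) + C (`HeckeReadout`) ⟹ `¬ C1`, sorry-free.

Disproof used: honours `quarterFingerprintDeficit_false_without_nonzero` (B carries `∃ z, u z ≠ 0`; a quasimode
certificate delivers it); produces exactly a `WindowSighting` (`not_deficit_iff_windowSighting`, Disproof §0);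
uses `apply_neg_one_eq_one_of_orderOf_eq_five` (χ even ⇒ Eisenstein `R`-even ⇒ odd sector pure point, the
paper side of A and B). No landed Negative lemma refutes A, B or C (A is a ~99%-likely census statement —
a second odd eigenvalue with `|r| ≤ 10⁻²` has Weyl probability `≈ 81·10⁻⁴`; B, C are the sighted object).
-/

set_option linter.dupNamespace false

noncomputable section

namespace Summit.Langlands.Langlands.Cruxes.QuarterFingerprintDeficit.GapReadout

open Summit.Langlands.Langlands.Theses.QuarterDeficit1951
open scoped BigOperators ComplexConjugate MatrixGroups
open UpperHalfPlane (J ofComplex)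

/-! ## 0. The crux's inlined `let`s, named (verbatim copies, as in Lines/ParityPurePoint.lean) -/

/-- `Φ = {0, 1, 4, (3 ± √5)/2}`. [folklore] -/
def Φ : Set ℂ := {0, 1, 4, (((3 + Real.sqrt 5) / 2 : ℝ) : ℂ), (((3 - Real.sqrt 5) / 2 : ℝ) : ℂ)}

/-- The six fingerprint primes. [folklore] -/
def P₀ : Finset ℕ := {2, 3, 5, 7, 11, 13}

/-- The crux's automorphy clause on `Γ₀(1951)` with nebentypus `χ(d)`. [folklore] -/
def IsAutomorphicChi (χ : DirichletCharacter ℂ 1951) (u : UpperHalfPlane → ℂ) : Prop :=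
  ∀ γ : Matrix.SpecialLinearGroup (Fin 2) ℤ, γ ∈ CongruenceSubgroup.Gamma0 1951 →
    ∀ z : UpperHalfPlane, u (γ • z) = χ ((γ 1 1 : ℤ) : ZMod 1951) * u z

/-- The crux's classical Hecke operator (unitary normalisation, nebentypus `χ`). [folklore] -/
def Tp (χ : DirichletCharacter ℂ 1951) (p : ℕ) (u : UpperHalfPlane → ℂ) (z : UpperHalfPlane) : ℂ :=
  ((Real.sqrt p : ℝ) : ℂ)⁻¹ *
    ((∑ b ∈ Finset.range p, u (ofComplex (((z : ℂ) + b) / p))) +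
      χ (p : ZMod 1951) * u (ofComplex ((p : ℂ) * z)))

/-- ODD under the reflection `R : z ↦ -z̄` (`UpperHalfPlane.J • z`). [folklore] -/
def IsOdd (u : UpperHalfPlane → ℂ) : Prop := ∀ z : UpperHalfPlane, u (J • z) = - u z

/-- An ODD bounded `C²` `Γ₀(1951)`-automorphic (nebentypus `χ`) eigenfunction of the hyperbolic Laplacian with
eigenvalue `lam` (no cusp clauses: they follow from oddness, stub P1; on paper such a `u` is an odd Maass CUSP form,
hence `L²`, hence a vector of the `lam`-eigenspace of the self-adjoint `Δ` on `L²_odd(Γ₀(1951)\ℍ, χ)`). [folklore] -/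
def IsOddEigenform (χ : DirichletCharacter ℂ 1951) (u : UpperHalfPlane → ℂ) (lam : ℝ) : Prop :=
  Literature.NumberTheory.Automorphic.IsC2 u ∧
  (∀ z, Literature.NumberTheory.Automorphic.hypLaplacian u z + (lam : ℂ) * u z = 0) ∧
  IsAutomorphicChi χ u ∧ (∃ C : ℝ, ∀ z, ‖u z‖ ≤ C) ∧ IsOdd u

/-! ## 1. Stubs -/

/-- STUB P1 (Lean, M; SAME statement as the registered stub of line ParityPurePoint, whose sorry-free proof is the
crux workfile Lines/ParityPurePointStubOddConstantTermsProof.lean — to be landed by a prover seat): an odd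
`Γ₀(1951)`-automorphic function has vanishing constant terms at both cusps, identically in `y`. [folklore] -/
theorem stub_oddConstantTerms (χ : DirichletCharacter ℂ 1951) (u : UpperHalfPlane → ℂ)
    (haut : ∀ γ : Matrix.SpecialLinearGroup (Fin 2) ℤ, γ ∈ CongruenceSubgroup.Gamma0 1951 →
      ∀ z : UpperHalfPlane, u (γ • z) = χ ((γ 1 1 : ℤ) : ZMod 1951) * u z)
    (hodd : ∀ z : UpperHalfPlane, u (UpperHalfPlane.J • z) = - u z) :
    (∀ y : ℝ, 0 < y → ∫ x in (0 : ℝ)..1, u (UpperHalfPlane.ofComplex (x + y * Complex.I)) = 0) ∧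
    (∀ y : ℝ, 0 < y →
      ∫ x in (0 : ℝ)..1951, u (ModularGroup.S • UpperHalfPlane.ofComplex (x + y * Complex.I)) = 0) := by
  sorry

/-- STUB A — ISOLATION (computational, `n = ±1` census; verdict class `computation`): for every order-5 `χ`
mod 1951, the odd cuspidal spectrum of `(Γ₀(1951), χ)` has AT MOST ONE Laplace eigenvalue, counted with
multiplicity, in the micro-window `|λ − 1/4| ≤ 10⁻⁴` (`|r| ≤ 10⁻²`); stated over functions: any two odd bounded
`C²` automorphic eigenfunctions in the micro-window are proportional. Certificate: `½ tr(T₁ − T₋₁) h` by the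
Booker–Lee–Strömbergsson trace formula (arXiv:1803.06016 Thm 7, `n = ±1`; §5 test functions, Arb) with a
nonnegative `h` peaked at `r = 0` and `Σ_{odd j} h(r_j) < 2 · min_{|r| ≤ 10⁻²} h(r)` — BLS §5 reports exactly
`Q_{χ,odd} = Σ_{odd j} h(r_j) − h(0) < 1` for N = 1951 (their minimiser gives it outright unless `Q > 0.98`);
re-run = the `n = 1` evaluator wanted by `CensusDeficit1951`; or small-`X` EXHAUSTION + coarse quasimodes.
Two characters (`χ₁`, `χ₁²`) + complex conjugation (`u ↦ ū` maps `(χ)`- to `(χ̄)`-eigenfunctions, same `λ`,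
parity preserved). WHY IT MIGHT FAIL: a second odd eigenvalue with `|r| ≤ 10⁻²` for some `χ` (Weyl odds
`≈ 81·10⁻⁴` per character) — then shrink the window to that `χ`'s actual gap or restrict to the clean conjugate
pair (B is existential). -/
def OddMicroWindowUnique : Prop :=
  ∀ χ : DirichletCharacter ℂ 1951, orderOf χ = 5 →
    ∀ (u₁ u₂ : UpperHalfPlane → ℂ) (lam₁ lam₂ : ℝ),
      IsOddEigenform χ u₁ lam₁ → IsOddEigenform χ u₂ lam₂ →
      |lam₁ - 1 / 4| ≤ 1 / 10000 → |lam₂ - 1 / 4| ≤ 1 / 10000 → (∃ z, u₁ z ≠ 0) →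
      ∃ c : ℂ, ∀ z, u₂ z = c * u₁ z

/-- STUB A as a theorem stub (registered signature). -/
theorem stub_oddMicroWindowUnique : OddMicroWindowUnique := by
  sorry

/-- STUB B — EXISTENCE (computational, odd quasimode; verdict class `computation`): for some order-5 `χ` there is
a nonzero odd bounded `C²` `Γ₀(1951)`-automorphic eigenfunction with `|λ − 1/4| ≤ 10⁻⁶`. Certificate: the odd
Artin-ansatz quasimode `g̃` at `(1951, χ₁)` (exact `a_n ∈ ℤ[ζ₅]`, `r = 0`, `M ≈ 1.2–2.5·10⁴` — the Ford floor dips to `≈ 0.4/N` where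
near-tangent isometric circles meet — two expansions glued on the Ford domain `D⁺ ∪ W_N D⁺`, point-pair smoothing of free radius `δ`), certified jump sup-bounds on the
side-paired floor arcs ⇒ `‖(Δ − 1/4) g̃‖ ≤ ε ‖g̃‖` with `ε ≤ 5·10⁻¹¹` RELATIVE (the readout C needs `ε/γ ≤ 5·10⁻⁷` — measured,
kit j024768 — and A gives `γ ≈ 10⁻⁴`), Child 2022 Lemma 4 inside `L²_odd` (pure point: Eisenstein series `R`-even) ⇒ an odd cusp form `u`
with `|λ_u − 1/4| ≤ ε`; regularity (elliptic) + `L²`-eigen in the odd sector ⇒ the clauses of `IsOddEigenform`.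
No Hecke content here. WHY IT MIGHT FAIL: only by the certificate being too weak (it cannot lie); the
`~10³`-arc jump computation is the lead's step (iii-a) at 13 digits instead of 22. -/
def OddMicroWindowForm : Prop :=
  ∃ χ : DirichletCharacter ℂ 1951, orderOf χ = 5 ∧ ∃ (u : UpperHalfPlane → ℂ) (lam : ℝ),
    IsOddEigenform χ u lam ∧ (∃ z, u z ≠ 0) ∧ |lam - 1 / 4| ≤ 1 / 1000000

/-- STUB B as a theorem stub (registered signature). -/
theorem stub_oddMicroWindowForm : OddMicroWindowForm := by
  sorry

/-- STUB C — IDENTIFICATION BY READOUT (paper lemma + Parseval integrals; verdict class `computation`): for every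
order-5 `χ`, every nonzero odd eigenform `u` with `|λ − 1/4| ≤ 10⁻⁶` which is, up to scalars, the ONLY odd
eigenform of `χ` in the micro-window `|λ − 1/4| ≤ 10⁻⁴`, is a `T_p`-eigenfunction (`p ≤ 13`) with eigenvalue in
a box `‖μ_p − a_p‖ ≤ r_p` around an EXACT centre `a_p` with `a_p² χ̄(p) ∈ Φ` and `r_p (2‖a_p‖ + r_p) ≤ 1/100`.
Paper lemma (3 lines of spectral calculus): `P` = projection on `ℂu` = the micro-window spectral projection of
`Δ_odd` (uniqueness), `‖(1 − P) g̃‖ ≤ (ε/γ)‖g̃‖`, `T P g̃ = μ P g̃`, hence for every `φ`,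
`|⟨T g̃, φ⟩ − μ⟨g̃, φ⟩| ≤ (ε/γ)‖g̃‖(‖T*φ‖ + |μ|‖φ‖)`; with `φ = f_M · 1_Ω`, `Ω = {|x| ≤ 1/2, 0.33 ≤ y ≤ 0.66}`
(all Hecke points of `Ω` stay above height `0.025`, inside `D⁺` minus the smoothing collar, where `g̃ = f_M` and
`T_p f_M = a_p f_M + tail_p` EXACTLY by the Hecke relations of the exact Artin coefficients):
`‖μ_p − a_p‖ ≤ |⟨tail_p, f_M⟩_Ω| / ‖f_M‖²_Ω + 2 ((p+1)/√p) (ε/γ) ‖g̃‖_X / ‖f_M‖_Ω` — Parseval 1-D integrals of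
`K₀²` only (`‖g̃‖_X` bounded above through the strip `y ≥ 1951⁻¹`). Certified at `χ₁`, `χ₁²`; conjugation gives
`χ̄` (`ā² χ(p) ∈ Φ` as `Φ ⊂ ℝ`). Admissible radii: `1/10` at `p = 5, 7` (`a_p = 0`), `1/250` at `p = 2, 13`,
`1/150` at `p = 3, 11`. WHY IT MIGHT FAIL: the norm ratio `‖g̃‖_X/‖f_M‖_Ω` sets the required `ε/γ` — MEASURED `≤ 1017`
(strip Parseval bound, kit j024768) ⇒ `ε/γ ≤ 5.1·10⁻⁷`; if the certified gap `γ` of A comes out `10⁻⁵` rather than `10⁻⁴`, B must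
deliver `ε ≤ 5·10⁻¹²` (jumps `≈ 5·10⁻¹⁵`, `M ≈ 2.7·10⁴`) — still above double precision, trivial in 128-bit Arb. -/
def HeckeReadout : Prop :=
  ∀ χ : DirichletCharacter ℂ 1951, orderOf χ = 5 →
    ∀ (u : UpperHalfPlane → ℂ) (lam : ℝ), IsOddEigenform χ u lam → (∃ z, u z ≠ 0) →
      |lam - 1 / 4| ≤ 1 / 1000000 →
      (∀ (u' : UpperHalfPlane → ℂ) (lam' : ℝ), IsOddEigenform χ u' lam' → |lam' - 1 / 4| ≤ 1 / 10000 →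
        ∃ c : ℂ, ∀ z, u' z = c * u z) →
      ∀ p ∈ P₀, ∃ (μ a : ℂ) (r : ℝ), a ^ 2 * conj (χ (p : ZMod 1951)) ∈ Φ ∧ 0 ≤ r ∧
        r * (2 * ‖a‖ + r) ≤ 1 / 100 ∧ (∀ z, Tp χ p u z = μ * u z) ∧ ‖μ - a‖ ≤ r

/-- STUB C as a theorem stub (registered signature). -/
theorem stub_heckeReadout : HeckeReadout := by
  sorry

/-! ## 2. Glue (proved) and the composition -/

/-- `‖χ(p)‖ = 1` at the six fingerprint primes (units mod the prime 1951). [folklore] -/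
theorem norm_chi_of_mem_P₀ (χ : DirichletCharacter ℂ 1951) {p : ℕ} (hp : p ∈ P₀) :
    ‖χ (p : ZMod 1951)‖ = 1 := by
  have hcop : Nat.Coprime p 1951 := by
    simp only [P₀, Finset.mem_insert, Finset.mem_singleton] at hp
    rcases hp with rfl | rfl | rfl | rfl | rfl | rfl <;> norm_num
  have h := χ.unit_norm_eq_one (ZMod.unitOfCoprime p hcop)
  rwa [ZMod.coe_unitOfCoprime] at h

/-- BOX ⇒ FINGERPRINT: `‖μ − a‖ ≤ r`, `r (2‖a‖ + r) ≤ 1/100`, `‖c‖ = 1` give `‖μ² c − a² c‖ ≤ 1/100`. [folklore] -/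
theorem box_fingerprint (μ a c : ℂ) (r : ℝ) (hc : ‖c‖ = 1) (hr0 : 0 ≤ r)
    (hr : r * (2 * ‖a‖ + r) ≤ 1 / 100) (hbox : ‖μ - a‖ ≤ r) :
    ‖μ ^ 2 * c - a ^ 2 * c‖ ≤ 1 / 100 := by
  have h1 : μ ^ 2 * c - a ^ 2 * c = (μ - a) * (μ + a) * c := by ring
  have h2 : ‖μ + a‖ ≤ r + 2 * ‖a‖ := by
    have e : μ + a = (μ - a) + 2 * a := by ring
    calc ‖μ + a‖ = ‖(μ - a) + 2 * a‖ := by rw [← e]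
      _ ≤ ‖μ - a‖ + ‖(2 : ℂ) * a‖ := norm_add_le _ _
      _ = ‖μ - a‖ + 2 * ‖a‖ := by rw [norm_mul, Complex.norm_two]
      _ ≤ r + 2 * ‖a‖ := by linarith
  rw [h1, norm_mul, norm_mul, hc, mul_one]
  calc ‖μ - a‖ * ‖μ + a‖ ≤ r * (r + 2 * ‖a‖) :=
        mul_le_mul hbox h2 (norm_nonneg _) hr0
    _ = r * (2 * ‖a‖ + r) := by ring
    _ ≤ 1 / 100 := hr

/-- The isolated micro-window eigenform of B, identified by C under the uniqueness A, is a window form with the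
fingerprint — i.e. a witness against C1 once P1 supplies the two constant-term clauses. Uses EVERY stub. -/
theorem not_QuarterFingerprintDeficit_of
    (hP1 : ∀ (χ : DirichletCharacter ℂ 1951) (u : UpperHalfPlane → ℂ), IsAutomorphicChi χ u → IsOdd u →
      (∀ y : ℝ, 0 < y → ∫ x in (0 : ℝ)..1, u (ofComplex (x + y * Complex.I)) = 0) ∧
      (∀ y : ℝ, 0 < y →
        ∫ x in (0 : ℝ)..1951, u (ModularGroup.S • ofComplex (x + y * Complex.I)) = 0))
    (hA : OddMicroWindowUnique) (hB : OddMicroWindowForm) (hC : HeckeReadout) :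
    ¬ QuarterFingerprintDeficit := by
  intro h₁
  obtain ⟨χ, hχ, u, lam, hEig, hne, hwin⟩ := hB
  have huniq : ∀ (u' : UpperHalfPlane → ℂ) (lam' : ℝ), IsOddEigenform χ u' lam' →
      |lam' - 1 / 4| ≤ 1 / 10000 → ∃ c : ℂ, ∀ z, u' z = c * u z := by
    intro u' lam' hEig' hwin'
    have hwinu : |lam - 1 / 4| ≤ 1 / 10000 := le_trans hwin (by norm_num)
    exact hA χ hχ u u' lam lam' hEig hEig' hwinu hwin' hne
  have hfp := hC χ hχ u lam hEig hne hwin huniq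
  obtain ⟨hC2, hΔ, haut, hbdd, hodd⟩ := hEig
  obtain ⟨hct₁, hct₂⟩ := hP1 χ u haut hodd
  have hwin' : |lam - 1 / 4| ≤ 1 / 100 := le_trans hwin (by norm_num)
  refine h₁ χ hχ ⟨u, lam, ⟨hC2, hΔ, haut, hct₁, hct₂, hbdd⟩, hne, hwin', fun p hp => ?_⟩
  obtain ⟨μ, a, r, hφ, hr0, hr, hT, hbox⟩ := hfp p hp
  refine ⟨μ, a ^ 2 * conj (χ (p : ZMod 1951)), hφ, hT, ?_⟩
  have hc : ‖conj (χ (p : ZMod 1951))‖ = 1 := by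
    rw [Complex.norm_conj]; exact norm_chi_of_mem_P₀ χ hp
  exact box_fingerprint μ a _ r hc hr0 hr hbox

/-- The composition with the four stubs plugged in: the skeleton's conclusion is literally `¬ C1`. -/
theorem not_QuarterFingerprintDeficit : ¬ QuarterFingerprintDeficit :=
  not_QuarterFingerprintDeficit_of stub_oddConstantTerms stub_oddMicroWindowUnique stub_oddMicroWindowForm
    stub_heckeReadout

end Summit.Langlands.Langlands.Cruxes.QuarterFingerprintDeficit.GapReadout

end
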